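import Literature.NumberTheory.EllipticCurves.BigRepModuleShiftStructureProofs
import Literature.NumberTheory.EllipticCurves.BigRepModuleShapiroInjectiveProofs
import Literature.NumberTheory.EllipticCurves.SkinnerUrban2014.CofinitelyGeneratedSelmerProofs
import Literature.NumberTheory.EllipticCurves.BigRepModuleShapiroLocalSplitProofs
import Literature.NumberTheory.GaloisRepresentations.ContinuousCorestriction
import Mathlib.RingTheory.PowerSeries.Trunc
import HarnessLib

/-!
# The co-induced module at a TOTALLY SPLIT group: `H¹(D, A ⊗ Λ^*(Ψ⁻¹)) ≅ H¹(D, A) ⊗ Λ^*` when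
# `Ψ|_D = 1`, as `Λ`-modules — PROVED

Topic `Literature/NumberTheory/EllipticCurves` (namespace = path + `BigRepModule`). THEOREMS ONLY: no
definition, no named fact, no instance, no `sorry`. Cell `bsd-stepL` (typer lane `defn-ty1`, g9),
module L2 of the discharge plan `HOME/defn-ty1/g9/NOTE-sigmaLocal-discharge-plan-defn-ty1-g9.md` for the
named LOCAL fact `JetchevSkinnerWan2017.sigmaLocal_charIdeal_eulerFactor_mem_of_noTamagawaDefect` (the
local term of the `Σ`-change at `w ∤ p`), TOTALLY SPLIT case: at a place `w` with `Ψ(Frob_w) = 1` the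
decomposition group `D_w` acts on `M = T ⊗ Λ^*(Ψ⁻¹)` through `ρ` alone, and
`H¹(K_w, M) = H¹(K_w, A) ⊗ Λ^∨`.

## The printed statement

[PollackWeston2011] Lemma 3.2 (arXiv:math/0610694 p. 7): "If `ℓ` is inert or ramified in `K/ℚ`, then
`ℓ` splits completely in `K_∞` and `ℋ_ℓ = H¹(K_ℓ, A_f) ⊗ Λ^∨` where `Λ^∨ = Hom_𝒪(Λ, F/𝒪)`";
[SkinnerUrban2014] §3.1.2 (3.1.2.b) (the places splitting completely in `F_∞/F`); [Castella2018]
Thm. 2.3 (2.7) (the factor `∏_{w∈Σ} #H¹(K_w, E[p^∞])`).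

## What is proved (tree's co-induced model `bigRep κ ρ` on `BigRepModule ℤ_[p] p A`; Mathlib's
## `continuousCohomology 1`; `Λ = ℤ_p⟦T⟧ = IwasawaAlgebra p`)

For a compact topological group `D`, a continuous `κ : D → ℤ_p` which is TRIVIAL (`κ d = 1`), and a
continuous `ℤ_p`-linear representation `ρ` of `D` on a discrete `p`-primary `A`:
* `map_smul_of_X_of_C_of_X_pow_smul_eq_zero` — generic forcing lemma: an additive map between `ℤ_p⟦T⟧`-modules commuting
  with `T` and with the constants is `ℤ_p⟦T⟧`-linear on every element killed by a power of `T`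
  (`PowerSeries.eq_X_pow_mul_shift_add_trunc`);
* **`exists_linearEquiv_h1_bigRep_of_forall_eq_one`** — a `Λ`-LINEAR isomorphism
  `H¹(D, bigRep κ ρ) ≃ₗ[Λ] BigRepModule ℤ_[p] p (H¹(D, A))` sending `[c]` to `x ↦ [d ↦ c(d)(x)]` (all
  evaluations at once; injective by the local Shapiro criterion at a subgroup where `κ` vanishes —
  [SU14] (3.1.2.b), the tree's `exists_eq_bigRep_sub_iff_forall_apply`, re-run here on the whole group;
  surjective by choosing representatives of the finitely many values of a smooth function);
* consequence (filed with module L3, `JetchevSkinnerWan2017/SigmaLocalTotallySplitProofs.lean`,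
  `moduleFinite_isTorsion_natCard_mem_charIdeal_h1_bigRep`): when `H¹(D, A)` is finite, the Pontryagin
  dual of `H¹(D, bigRep κ ρ)` is finitely generated torsion with `#H¹(D, A) ∈ Ch_Λ` (module L1).

HONEST FRAMING: group cohomology of the co-induced module with trivial twist; nothing about elliptic
curves, local fields or BSD is proved here; the named fact is NOT discharged by this file (modules L3–L6:
`κ ∘ localMap = 1` at a totally split place, the order of `H¹(K_w, E[p^∞])` against `P_w(1)`, the finitely
decomposed places, assembly).

References: [PollackWeston2011] Lemma 3.2; [SkinnerUrban2014] §3.1.1–3.1.2, Prop. 3.2.3;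
[Castella2018] Thm. 2.3 (2.7); [SerreGaloisCohomology1997] I §2.2, §2.5. Tree:
`AnticyclotomicBigGaloisRep.lean` (`bigRep`, `BigRepModule`), `BigRepModuleShapiroLocalSplitProofs.lean`
(M3a, `exists_common_level`), `BigRepModuleShapiroInjectiveProofs.lean` (`exists_uniform_pow_smul_eq_zero`),
`SelmerCocycleLiftUnramifiedFiniteProofs.lean` (cocycle torsion), `GaloisRepresentations/ContinuousH1.lean`,
`ContinuousCorestriction.lean` (`liftH1ₗ`).
-/

noncomputable section

open Multiplicative Topology
open Literature.NumberTheory.GaloisRepresentations Literature.NumberTheory.EllipticCurves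
  Literature.NumberTheory.EllipticCurves.BigGaloisRep

namespace Literature.NumberTheory.EllipticCurves.BigRepModule

universe u

/-! ## §1 Forcing `ℤ_p⟦T⟧`-linearity from `T`- and constant-linearity on `T`-power-torsion elements -/

section Forcing

variable {R : Type*} [CommRing R] {M₁ M₂ : Type*} [AddCommGroup M₁] [Module (PowerSeries R) M₁]
  [AddCommGroup M₂] [Module (PowerSeries R) M₂]

/-- An additive map between `R⟦T⟧`-modules commuting with `T` and with the constants `C a` commutes with
every POLYNOMIAL in `T`. [folklore] -/
private theorem map_coe_polynomial_smul (φ : M₁ →+ M₂)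
    (hX : ∀ m, φ ((PowerSeries.X : PowerSeries R) • m) = (PowerSeries.X : PowerSeries R) • φ m)
    (hC : ∀ (a : R) m, φ ((PowerSeries.C a : PowerSeries R) • m) = (PowerSeries.C a : PowerSeries R) • φ m)
    (q : Polynomial R) (m : M₁) : φ ((q : PowerSeries R) • m) = (q : PowerSeries R) • φ m := by
  induction q using Polynomial.induction_on generalizing m with
  | C a => rw [Polynomial.coe_C, hC]
  | add f g hf hg => rw [Polynomial.coe_add, add_smul, add_smul, map_add, hf, hg]
  | monomial n a ih =>
    rw [pow_succ, ← mul_assoc, Polynomial.coe_mul, Polynomial.coe_X, mul_smul, mul_smul, ih, hX]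

/-- **FORCING LEMMA.** An additive map `φ : M₁ → M₂` of `R⟦T⟧`-modules with `φ(T·m) = T·φ(m)` and
`φ(C a·m) = C a·φ(m)` satisfies `φ(f·m) = f·φ(m)` for every `f ∈ R⟦T⟧` and every `m` killed by a power of
`T`: split `f = Tᴺ·g + trunc_N f` (`PowerSeries.eq_X_pow_mul_shift_add_trunc`); the first summand kills
`m` and `φ(m)`, the second is a polynomial. (The `Λ`-action on a discrete module "every element of which
is killed by `Tⁿ` for some `n`" is through `Λ/Tⁿ`.) [cite: GreenbergLNM1716, §1 (discrete Λ-modules, after Conj. 1.3)] -/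
theorem map_smul_of_X_of_C_of_X_pow_smul_eq_zero (φ : M₁ →+ M₂)
    (hX : ∀ m, φ ((PowerSeries.X : PowerSeries R) • m) = (PowerSeries.X : PowerSeries R) • φ m)
    (hC : ∀ (a : R) m, φ ((PowerSeries.C a : PowerSeries R) • m) = (PowerSeries.C a : PowerSeries R) • φ m)
    {m : M₁} {N : ℕ} (hm : (PowerSeries.X : PowerSeries R) ^ N • m = 0) (f : PowerSeries R) :
    φ (f • m) = f • φ m := by
  have hXpow : ∀ (n : ℕ) (m' : M₁), φ ((PowerSeries.X : PowerSeries R) ^ n • m') =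
      (PowerSeries.X : PowerSeries R) ^ n • φ m' := fun n ↦ by
    induction n with
    | zero => intro m'; rw [pow_zero, one_smul, one_smul]
    | succ n ih => intro m'; rw [pow_succ, mul_smul, mul_smul, ih, hX]
  have hφm : (PowerSeries.X : PowerSeries R) ^ N • φ m = 0 := by rw [← hXpow, hm, map_zero]
  set g : PowerSeries R := PowerSeries.mk fun i ↦ PowerSeries.coeff (i + N) f with hg
  have hf : f = PowerSeries.X ^ N * g + (f.trunc N : PowerSeries R) :=
    PowerSeries.eq_X_pow_mul_shift_add_trunc N f
  have h1 : f • m = (f.trunc N : PowerSeries R) • m := by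
    conv_lhs => rw [hf]
    rw [add_smul, (PowerSeries.commute_X_pow g N).symm.eq, mul_smul, hm, smul_zero, zero_add]
  have h2 : f • φ m = (f.trunc N : PowerSeries R) • φ m := by
    conv_lhs => rw [hf]
    rw [add_smul, (PowerSeries.commute_X_pow g N).symm.eq, mul_smul, hφm, smul_zero, zero_add]
  rw [h1, h2, map_coe_polynomial_smul φ hX hC]

end Forcing

/-! ## §2 The evaluation cocycles and the `Λ`-linear Shapiro map `[c] ↦ (x ↦ [d ↦ c(d)(x)])` -/

section TotallySplit

variable {p : ℕ} [hp : Fact p.Prime] {A : Type u} [AddCommGroup A] [Module ℤ_[p] A]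
  [TopologicalSpace A] [DiscreteTopology A] [ContinuousSMul ℤ_[p] A]
  {D : Type u} [Group D] [TopologicalSpace D] [IsTopologicalGroup D] [CompactSpace D]
  [TopologicalSpace (PowerSeries ℤ_[p])] [ContinuousSMul (PowerSeries ℤ_[p]) (BigRepModule ℤ_[p] p A)]
  (κ : D →ₜ* Multiplicative ℤ_[p]) (hκ : ∀ d : D, κ d = 1) (ρ : ContinuousRep D ℤ_[p] A)

omit [CompactSpace D] in
/-- **The evaluation cocycle.** When `κ` is trivial, `D` acts on `M = BigRepModule` pointwise through
`ρ`, so for a continuous 1-cocycle `c` of `bigRep κ ρ` and `x ∈ ℤ_p` the evaluation `d ↦ c(d)(x)` is a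
continuous 1-cocycle of `ρ`. [cite: SkinnerUrban2014, §3.1.2 ((3.1.2.b): at a place splitting completely the local term is `⊕ H¹(F_w, T ⊗ A^*)`)] -/
theorem exists_contOneCocycles_eval (hκ : ∀ d : D, κ d = 1)
    (c : contOneCocycles (bigRep κ ρ).toTopRep) (x : ℤ_[p]) :
    ∃ z : contOneCocycles ρ.toTopRep, ∀ d : D, z.1 d = (c.1 d : BigRepModule ℤ_[p] p A) x := by
  refine ⟨⟨⟨fun d ↦ (c.1 d : BigRepModule ℤ_[p] p A) x,
    (continuous_of_discreteTopology (f := fun Φ : BigRepModule ℤ_[p] p A ↦ Φ x)).comp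
      c.1.continuous⟩, fun g h ↦ ?_⟩, fun d ↦ rfl⟩
  have e := congrArg (fun Φ : BigRepModule ℤ_[p] p A ↦ Φ x) (c.2 g h)
  simp only at e
  change (c.1 (g * h) : BigRepModule ℤ_[p] p A) x =
    (c.1 g : BigRepModule ℤ_[p] p A) x + ρ.toTopRep.ρ g ((c.1 h : BigRepModule ℤ_[p] p A) x)
  rw [e, BigRepModule.add_apply, toTopRep_ρ_apply, toTopRep_ρ_apply, bigRep_apply_apply, hκ g,
    toAdd_one, sub_zero]

omit [ContinuousSMul ℤ_[p] A] in
/-- The values of a continuous cocycle of `bigRep κ ρ` (compact `D`, discrete `M`) have a COMMON level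
and a COMMON `p`-power exponent. [cite: SkinnerUrban2014, §3.1.1 (Λ^* = lim→ Maps(Γ/Γ^{pⁿ}, ·))] -/
theorem exists_level_and_torsion (c : contOneCocycles (bigRep κ ρ).toTopRep) :
    ∃ n k : ℕ, (∀ (d : D) (y z : ℤ_[p]), y - z ∈ Ideal.span {(p : ℤ_[p]) ^ n} →
        (c.1 d : BigRepModule ℤ_[p] p A) y = (c.1 d : BigRepModule ℤ_[p] p A) z) ∧
      ∀ (d : D) (x : ℤ_[p]), p ^ k • (c.1 d : BigRepModule ℤ_[p] p A) x = 0 := by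
  have hfin : (Set.range fun d : D ↦ (c.1 d : BigRepModule ℤ_[p] p A)).Finite :=
    contOneCocycles.finite_range (bigRep κ ρ).toTopRep c
  obtain ⟨n, hn⟩ := exists_common_level (𝒪 := ℤ_[p]) hfin
  obtain ⟨k, hk⟩ := contOneCocycles.exists_pow_smul_apply_eq_zero (bigRep κ ρ).toTopRep
    (PowerSeries.C (p : ℤ_[p]) : PowerSeries ℤ_[p]) (fun Φ ↦ exists_C_natCast_pow_smul_eq_zero Φ) c
  refine ⟨n, k, hn, fun d x ↦ ?_⟩
  have h := congrArg (fun Φ : BigRepModule ℤ_[p] p A ↦ Φ x) (hk d)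
  simp only at h
  rwa [← map_pow, C_smul, BigRepModule.smul_apply, BigRepModule.zero_apply, ← Nat.cast_pow,
    Nat.cast_smul_eq_nsmul] at h

/-- **The Shapiro map on cocycles, all evaluations at once**: for a continuous cocycle `c` of
`bigRep κ ρ` (`κ` trivial) there is a smooth `p`-primary function `Φ_c : ℤ_p → H¹(D, A)` with
`Φ_c(x) = [d ↦ c(d)(x)]`. [cite: SkinnerUrban2014, §3.1.2 ((3.1.2.b))] [cite: PollackWeston2011, Lemma 3.2] -/
theorem exists_bigRepModule_eval (hκ : ∀ d : D, κ d = 1) (c : contOneCocycles (bigRep κ ρ).toTopRep) :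
    ∃ Φ : BigRepModule ℤ_[p] p (continuousCohomology 1 ρ.toTopRep),
      ∀ (x : ℤ_[p]) (z : contOneCocycles ρ.toTopRep),
        (∀ d : D, z.1 d = (c.1 d : BigRepModule ℤ_[p] p A) x) →
          Φ x = oneCocycleClass ρ.toTopRep z := by
  classical
  choose z hz using exists_contOneCocycles_eval κ ρ hκ c
  obtain ⟨n, k, hn, hk⟩ := exists_level_and_torsion κ ρ c
  have hzz : ∀ (x : ℤ_[p]) (z' : contOneCocycles ρ.toTopRep),
      (∀ d : D, z'.1 d = (c.1 d : BigRepModule ℤ_[p] p A) x) → z' = z x := fun x z' hz' ↦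
    Subtype.ext (ContinuousMap.ext fun d ↦ by rw [hz', hz])
  refine ⟨BigRepModule.mk (fun x ↦ oneCocycleClass ρ.toTopRep (z x)) ⟨⟨n, fun x y hxy ↦ ?_⟩,
    ⟨k, fun x ↦ ?_⟩⟩, fun x z' hz' ↦ by rw [BigRepModule.mk_apply, hzz x z' hz']⟩
  · -- level `n`
    simp only
    rw [hzz y (z x) fun d ↦ by rw [hz, hn d x y hxy]]
  · -- torsion `p^k`
    simp only
    rw [← Nat.cast_smul_eq_nsmul ℤ_[p], ← oneCocycleClass_smul,
      contOneCocycles.smul_eq_zero_of_forall ρ.toTopRep _ (z x) fun d ↦ ?_, oneCocycleClass_zero]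
    rw [hz, Nat.cast_smul_eq_nsmul]
    exact hk d x

/-- **The `Λ`-linear Shapiro map on `H¹` at a totally split group**, `[c] ↦ (x ↦ [d ↦ c(d)(x)])`:
there is a `Λ`-linear map `Sh : H¹(D, bigRep κ ρ) → BigRepModule ℤ_[p] p (H¹(D, A))` computing all
evaluations (well defined on classes: a coboundary `d·Φ − Φ` evaluates to the coboundaries
`ρ(d)Φ(x) − Φ(x)`; `Λ`-linear by the forcing lemma, `T` acting on both sides by `τ₁ − 1`).
[cite: SkinnerUrban2014, §3.1.2 ((3.1.2.b)) and Prop. 3.2.3] [cite: PollackWeston2011, Lemma 3.2] -/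
theorem exists_linearMap_h1_eval (hκ : ∀ d : D, κ d = 1) :
    ∃ Sh : continuousCohomology 1 (bigRep κ ρ).toTopRep →ₗ[PowerSeries ℤ_[p]]
        BigRepModule ℤ_[p] p (continuousCohomology 1 ρ.toTopRep),
      ∀ (c : contOneCocycles (bigRep κ ρ).toTopRep) (x : ℤ_[p]) (z : contOneCocycles ρ.toTopRep),
        (∀ d : D, z.1 d = (c.1 d : BigRepModule ℤ_[p] p A) x) →
          Sh (oneCocycleClass _ c) x = oneCocycleClass ρ.toTopRep z := by
  classical
  set X := (bigRep κ ρ).toTopRep with hXdef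
  set Y := ρ.toTopRep with hYdef
  choose Φ hΦ using exists_bigRepModule_eval κ ρ hκ
  choose z hz using exists_contOneCocycles_eval κ ρ hκ
  -- values of `Φ c` at `x` through the canonical evaluation cocycle `z c x`
  have hΦz : ∀ c x, Φ c x = oneCocycleClass Y (z c x) := fun c x ↦ hΦ c x (z c x) (hz c x)
  -- additivity
  have hadd : ∀ c c', Φ (c + c') = Φ c + Φ c' := fun c c' ↦ by
    refine BigRepModule.ext fun x ↦ ?_
    rw [BigRepModule.add_apply, hΦz c x, hΦz c' x, ← oneCocycleClass_add]
    refine hΦ (c + c') x _ fun d ↦ ?_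
    change (z c x).1 d + (z c' x).1 d =
      ((c.1 d : BigRepModule ℤ_[p] p A) + (c'.1 d : BigRepModule ℤ_[p] p A)) x
    rw [hz, hz, BigRepModule.add_apply]
  let sh : contOneCocycles X →+ BigRepModule ℤ_[p] p (continuousCohomology 1 Y) :=
    { toFun := Φ, map_zero' := by
        have h := hadd 0 0
        rwa [add_zero, left_eq_add] at h
      map_add' := hadd }
  have hsh : ∀ c, sh c = Φ c := fun _ ↦ rfl
  -- `T`-linearity: `(T·c)(d)(x) = c(d)(x+1) − c(d)(x)`
  have hX : ∀ c, sh ((PowerSeries.X : PowerSeries ℤ_[p]) • c) =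
      (PowerSeries.X : PowerSeries ℤ_[p]) • sh c := fun c ↦ by
    refine BigRepModule.ext fun x ↦ ?_
    rw [hsh, hsh, X_smul_apply, hΦz c (x + 1), hΦz c x, ← oneCocycleClass_sub]
    refine hΦ _ x _ fun d ↦ ?_
    change (z c (x + 1)).1 d - (z c x).1 d =
      ((PowerSeries.X : PowerSeries ℤ_[p]) • (c.1 d : BigRepModule ℤ_[p] p A)) x
    rw [hz, hz, X_smul_apply]
  -- constants
  have hC : ∀ (a : ℤ_[p]) c, sh ((PowerSeries.C a : PowerSeries ℤ_[p]) • c) =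
      (PowerSeries.C a : PowerSeries ℤ_[p]) • sh c := fun a c ↦ by
    refine BigRepModule.ext fun x ↦ ?_
    rw [hsh, hsh, C_smul, BigRepModule.smul_apply, hΦz c x, ← oneCocycleClass_smul]
    refine hΦ _ x _ fun d ↦ ?_
    change a • (z c x).1 d =
      ((PowerSeries.C a : PowerSeries ℤ_[p]) • (c.1 d : BigRepModule ℤ_[p] p A)) x
    rw [hz, C_smul, BigRepModule.smul_apply]
  -- `Λ`-linearity by forcing (every cocycle is killed by a power of `T`)
  let shₗ : contOneCocycles X →ₗ[PowerSeries ℤ_[p]] BigRepModule ℤ_[p] p (continuousCohomology 1 Y) :=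
    { toFun := Φ, map_add' := hadd, map_smul' := fun f c ↦ by
        obtain ⟨N, hN⟩ := contOneCocycles.exists_pow_smul_apply_eq_zero X
          (PowerSeries.X : PowerSeries ℤ_[p]) (fun Ψ ↦ exists_X_pow_smul_eq_zero Ψ) c
        have hc : (PowerSeries.X : PowerSeries ℤ_[p]) ^ N • c = 0 :=
          contOneCocycles.smul_eq_zero_of_forall X _ c hN
        exact map_smul_of_X_of_C_of_X_pow_smul_eq_zero sh hX hC hc f }
  have hshₗ : ∀ c, shₗ c = Φ c := fun _ ↦ rfl
  -- descent to `H¹`: coboundaries evaluate to coboundaries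
  have hdesc : ∀ c, oneCocycleClass X c = 0 → shₗ c = 0 := by
    intro c hc
    obtain ⟨Ψ, hΨ⟩ := (oneCocycleClass_eq_zero_iff X c).1 hc
    rw [hshₗ]
    refine BigRepModule.ext fun x ↦ ?_
    rw [hΦz, BigRepModule.zero_apply, oneCocycleClass_eq_zero_iff]
    refine ⟨(Ψ : BigRepModule ℤ_[p] p A) x, fun d ↦ ?_⟩
    rw [hz, hΨ d]
    change (bigRep κ ρ d Ψ - Ψ : BigRepModule ℤ_[p] p A) x = ρ d ((Ψ : BigRepModule ℤ_[p] p A) x) -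
      (Ψ : BigRepModule ℤ_[p] p A) x
    rw [BigRepModule.sub_apply, bigRep_apply_apply, hκ d, toAdd_one, sub_zero]
  refine ⟨liftH1ₗ X shₗ hdesc, fun c x z' hz' ↦ ?_⟩
  rw [liftH1ₗ_oneCocycleClass, hshₗ]
  exact hΦ c x z' hz'

/-! ## §3 Bijectivity: the local Shapiro criterion (injective) and representatives (surjective) -/

omit [ContinuousSMul ℤ_[p] A] in
/-- **Injectivity** (the local Shapiro criterion at a totally split group, [SU14] (3.1.2.b); the tree's
`exists_eq_bigRep_sub_iff_forall_apply` re-run on the whole group): a continuous cocycle of `bigRep κ ρ`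
(`κ` trivial) all of whose evaluations are coboundaries is a coboundary — primitives chosen along the
residues mod `pⁿ`, `n` a common level, give a SMOOTH primitive.
[cite: SkinnerUrban2014, §3.1.2 ((3.1.2.b))] [cite: GreenbergLNM1716, §1] -/
theorem oneCocycleClass_eq_zero_of_forall_eval (hκ : ∀ d : D, κ d = 1)
    (hA : ∀ a : A, ∃ k : ℕ, p ^ k • a = 0) (c : contOneCocycles (bigRep κ ρ).toTopRep)
    (h : ∀ x : ℤ_[p], ∃ a : A, ∀ d : D, (c.1 d : BigRepModule ℤ_[p] p A) x = ρ d a - a) :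
    oneCocycleClass _ c = 0 := by
  classical
  choose a ha using h
  obtain ⟨n, k, hn, -⟩ := exists_level_and_torsion κ ρ c
  haveI : NeZero (p ^ n) := ⟨pow_ne_zero n hp.out.ne_zero⟩
  set r : ℤ_[p] → ℤ_[p] := fun x ↦ ((PadicInt.toZModPow n x).val : ℤ_[p]) with hr
  have hrx : ∀ x : ℤ_[p], x - r x ∈ Ideal.span {(p : ℤ_[p]) ^ n} := by
    intro x
    rw [← PadicInt.ker_toZModPow, RingHom.mem_ker, map_sub, map_natCast, ZMod.natCast_zmod_val,
      sub_self]
  have hrr : ∀ x y : ℤ_[p], x - y ∈ Ideal.span {(p : ℤ_[p]) ^ n} → r x = r y := by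
    intro x y hxy
    have : PadicInt.toZModPow n x = PadicInt.toZModPow n y := by
      rw [← sub_eq_zero, ← map_sub, ← RingHom.mem_ker, PadicInt.ker_toZModPow]
      exact hxy
    simp only [hr, this]
  set Φf : ℤ_[p] → A := fun x ↦ a (r x) with hΦf
  have hsmooth : IsSmoothOfLevel p A n Φf := fun x y hxy ↦ by simp only [hΦf, hrr x y hxy]
  have hfin : (Set.range Φf).Finite := by
    refine (Set.finite_range (fun t : ZMod (p ^ n) ↦ a ((t.val : ℕ) : ℤ_[p]))).subset ?_
    rintro _ ⟨x, rfl⟩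
    exact ⟨PadicInt.toZModPow n x, rfl⟩
  obtain ⟨k', hk'⟩ := exists_uniform_pow_smul_eq_zero (p := p) hfin (fun x ↦ hA (Φf x))
  rw [oneCocycleClass_eq_zero_iff]
  set Ψ : BigRepModule ℤ_[p] p A := BigRepModule.mk Φf ⟨⟨n, hsmooth⟩, ⟨k', hk'⟩⟩ with hΨ
  refine ⟨Ψ, fun d ↦ BigRepModule.ext fun x ↦ ?_⟩
  change (c.1 d : BigRepModule ℤ_[p] p A) x = bigRep κ ρ d Ψ x - Ψ x
  rw [bigRep_apply_apply, hκ d, toAdd_one, sub_zero, hΨ, BigRepModule.mk_apply, hn d x (r x) (hrx x)]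
  exact ha (r x) d

omit [TopologicalSpace (PowerSeries ℤ_[p])] in
/-- A smooth function `ℤ_p → H` has finite range (it factors through `ℤ/pⁿ`). [folklore] -/
private theorem finite_range_aux {H : Type*} [AddCommGroup H] [Module ℤ_[p] H]
    (Φ : BigRepModule ℤ_[p] p H) : (Set.range (Φ : ℤ_[p] → H)).Finite := by
  classical
  obtain ⟨n, hn⟩ := Φ.exists_level
  haveI : NeZero (p ^ n) := ⟨pow_ne_zero n hp.out.ne_zero⟩
  refine (Set.finite_range (fun t : ZMod (p ^ n) ↦ Φ ((t.val : ℕ) : ℤ_[p]))).subset ?_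
  rintro _ ⟨x, rfl⟩
  refine ⟨PadicInt.toZModPow n x, hn _ _ ?_⟩
  rw [← PadicInt.ker_toZModPow, RingHom.mem_ker, map_sub, map_natCast, ZMod.natCast_zmod_val,
    sub_self]

/-- **Surjectivity**: every smooth `p`-primary `F : ℤ_p → H¹(D, A)` is `x ↦ [d ↦ c(d)(x)]` for a
continuous cocycle `c` of `bigRep κ ρ` (`κ` trivial) — `c(d)(x) := z_{F(x)}(d)` for chosen
representatives `z_h` of the finitely many values `h` of `F` (smooth of the level of `F`; uniformly
`p`-power torsion and continuous because only finitely many cocycles occur).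
[cite: SkinnerUrban2014, §3.1.2 ((3.1.2.b))] [cite: PollackWeston2011, Lemma 3.2] -/
theorem exists_cocycle_of_bigRepModule_h1 (hκ : ∀ d : D, κ d = 1) (hA : ∀ a : A, ∃ k : ℕ, p ^ k • a = 0)
    (F : BigRepModule ℤ_[p] p (continuousCohomology 1 ρ.toTopRep)) :
    ∃ c : contOneCocycles (bigRep κ ρ).toTopRep, ∀ (x : ℤ_[p]) (z : contOneCocycles ρ.toTopRep),
      (∀ d : D, z.1 d = (c.1 d : BigRepModule ℤ_[p] p A) x) → oneCocycleClass ρ.toTopRep z = F x := by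
  classical
  -- representatives of classes
  choose rep hrep using oneCocycleClass_surjective ρ.toTopRep
  obtain ⟨n, hn⟩ := F.exists_level
  -- the finitely many cocycles `rep (F x)` and a uniform torsion exponent
  have hFfin : (Set.range (F : ℤ_[p] → continuousCohomology 1 ρ.toTopRep)).Finite := finite_range_aux F
  have hpA : ∀ a : A, ∃ m : ℕ, (p : ℤ_[p]) ^ m • a = 0 := fun a ↦
    (hA a).imp fun m hm ↦ by rw [← Nat.cast_pow, Nat.cast_smul_eq_nsmul]; exact hm
  have hval : ∀ h ∈ hFfin.toFinset, ∃ m : ℕ, ∀ d : D, (p : ℤ_[p]) ^ m • (rep h).1 d = 0 := fun h _ ↦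
    contOneCocycles.exists_pow_smul_apply_eq_zero ρ.toTopRep (p : ℤ_[p]) hpA (rep h)
  choose! ex hex using hval
  set k : ℕ := hFfin.toFinset.sup ex with hk
  have hmemF : ∀ x, F x ∈ hFfin.toFinset := fun x ↦ hFfin.mem_toFinset.2 ⟨x, rfl⟩
  have htor : ∀ (d : D) (x : ℤ_[p]), p ^ k • (rep (F x)).1 d = 0 := fun d x ↦ by
    rw [← Nat.cast_smul_eq_nsmul ℤ_[p], Nat.cast_pow]
    exact contOneCocycles.pow_smul_apply_eq_zero_of_le ρ.toTopRep (p : ℤ_[p]) (rep (F x))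
      (hex _ (hmemF x))
      (Finset.le_sup (f := ex) (hmemF x)) d
  -- the big cocycle, value by value
  let cval : D → BigRepModule ℤ_[p] p A := fun d ↦ BigRepModule.mk (fun x ↦ (rep (F x)).1 d)
    ⟨⟨n, fun x y hxy ↦ by simp only [hn x y hxy]⟩, ⟨k, fun x ↦ htor d x⟩⟩
  have hcval : ∀ d x, cval d x = (rep (F x)).1 d := fun _ _ ↦ rfl
  -- continuity: locally constant (finitely many continuous cocycles into the discrete `A`)
  have hcont : Continuous cval := by
    refine ((IsLocallyConstant.iff_eventually_eq cval).2 fun d₀ ↦ ?_).continuous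
    have hopen : ∀ h : continuousCohomology 1 ρ.toTopRep,
        IsOpen {d : D | (rep h).1 d = (rep h).1 d₀} := fun h ↦
      (isOpen_discrete {(rep h).1 d₀}).preimage (ContinuousMap.continuous (rep h).1)
    have hS : IsOpen (⋂ h ∈ hFfin.toFinset, {d : D | (rep h).1 d = (rep h).1 d₀}) :=
      isOpen_biInter_finset fun h _ ↦ hopen h
    have hd₀ : d₀ ∈ ⋂ h ∈ hFfin.toFinset, {d : D | (rep h).1 d = (rep h).1 d₀} :=
      Set.mem_iInter₂.2 fun _ _ ↦ rfl
    filter_upwards [hS.mem_nhds hd₀] with d hd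
    simp only [Set.mem_iInter, Set.mem_setOf_eq] at hd
    exact BigRepModule.ext fun x ↦ by rw [hcval, hcval, hd _ (hmemF x)]
  -- cocycle identity, pointwise
  have hcoc : ∀ g h : D, cval (g * h) = cval g + (bigRep κ ρ).toTopRep.ρ g (cval h) := fun g h ↦ by
    refine BigRepModule.ext fun x ↦ ?_
    rw [BigRepModule.add_apply, hcval, hcval, toTopRep_ρ_apply, bigRep_apply_apply, hκ g, toAdd_one,
      sub_zero, hcval, (rep (F x)).2 g h, toTopRep_ρ_apply]
  refine ⟨⟨⟨cval, hcont⟩, hcoc⟩, fun x z hz ↦ ?_⟩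
  have hzx : z = rep (F x) := Subtype.ext (ContinuousMap.ext fun d ↦ by rw [hz]; rfl)
  rw [hzx, hrep]

/-- **`H¹(D, A ⊗ Λ^*(Ψ⁻¹)) ≅ H¹(D, A) ⊗ Λ^*` AS `Λ`-MODULES at a totally split group** (`κ|_D = 1`):
a `Λ`-linear isomorphism `H¹(D, bigRep κ ρ) ≃ₗ[Λ] BigRepModule ℤ_[p] p (H¹(D, A))` computing all
evaluations, for a compact `D` and a discrete `p`-primary `A` (`exists_linearMap_h1_eval`, injective by
`oneCocycleClass_eq_zero_of_forall_eval`, surjective by `exists_cocycle_of_bigRepModule_h1`).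
[cite: PollackWeston2011, Lemma 3.2 ("`ℋ_ℓ = H¹(K_ℓ, A_f) ⊗ Λ^∨`")]
[cite: SkinnerUrban2014, §3.1.2 ((3.1.2.b), the places splitting completely) and Prop. 3.2.3] -/
theorem exists_linearEquiv_h1_bigRep_of_forall_eq_one (hκ : ∀ d : D, κ d = 1)
    (hA : ∀ a : A, ∃ k : ℕ, p ^ k • a = 0) :
    ∃ e : continuousCohomology 1 (bigRep κ ρ).toTopRep ≃ₗ[PowerSeries ℤ_[p]]
        BigRepModule ℤ_[p] p (continuousCohomology 1 ρ.toTopRep),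
      ∀ (c : contOneCocycles (bigRep κ ρ).toTopRep) (x : ℤ_[p]) (z : contOneCocycles ρ.toTopRep),
        (∀ d : D, z.1 d = (c.1 d : BigRepModule ℤ_[p] p A) x) →
          e (oneCocycleClass _ c) x = oneCocycleClass ρ.toTopRep z := by
  obtain ⟨Sh, hSh⟩ := exists_linearMap_h1_eval κ ρ hκ
  choose z hz using exists_contOneCocycles_eval κ ρ hκ
  have hinj : Function.Injective Sh := by
    refine (injective_iff_map_eq_zero Sh).2 fun ξ hξ ↦ ?_
    obtain ⟨c, rfl⟩ := oneCocycleClass_surjective _ ξ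
    refine oneCocycleClass_eq_zero_of_forall_eval κ ρ hκ hA c fun x ↦ ?_
    have hx : oneCocycleClass ρ.toTopRep (z c x) = 0 := by
      rw [← hSh c x (z c x) (hz c x), hξ, BigRepModule.zero_apply]
    obtain ⟨a, ha⟩ := (oneCocycleClass_eq_zero_iff _ _).1 hx
    exact ⟨a, fun d ↦ by rw [← hz c x d, ha d, toTopRep_ρ_apply]⟩
  have hsurj : Function.Surjective Sh := fun F ↦ by
    obtain ⟨c, hc⟩ := exists_cocycle_of_bigRepModule_h1 κ ρ hκ hA F
    exact ⟨oneCocycleClass _ c, BigRepModule.ext fun x ↦ by rw [hSh c x (z c x) (hz c x), hc x (z c x) (hz c x)]⟩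
  exact ⟨LinearEquiv.ofBijective Sh ⟨hinj, hsurj⟩, fun c x z' hz' ↦ by
    rw [LinearEquiv.ofBijective_apply]; exact hSh c x z' hz'⟩

end TotallySplit

end Literature.NumberTheory.EllipticCurves.BigRepModule

end
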